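import Literature.AlgebraicGeometry.Frobenioids.DivisorMonoidCategoryTheoreticityCorSchemaNegative
import HarnessLib

/-!
# Frobenioids I, Corollary 4.10 and Corollary 4.11 (iii) AS TYPED over the data-only interfaces: the
# universal closures are false — kernel `¬ ∀` (FACT-LIST rows F-1024, F-1027; schema / R5)

Mochizuki, *The geometry of Frobenioids I: the general theory*, Kyushu J. Math. **62** (2008)
293–400, Cor. 4.10, kurims text p. 90, and Cor. 4.11 (iii), p. 92 [cite: MochizukiFrdI2008, Cor. 4.10 p.90]
[cite: MochizukiFrdI2008, Cor. 4.11 (iii) p.92].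

PROOF-ONLY companion (no definitions, no instances), sequel of
`DivisorMonoidCategoryTheoreticityCorSchemaNegative.lean` (same seat: cell abc-iut, F fact-proving wave, seat
abc-iut-f-032), for the FACT-LIST rows **F-1024** `PreFrobenioidData.Cor410` and **F-1027**
`PreFrobenioidData.Cor411iii` (class `preparatory`, kernel_closedness `parametrised`) of the statement file
`DivisorMonoidCategoryTheoreticity.lean` (seat abc-iut-L1-t3).

Both rows quantify, besides the data-only operations `S_i : PreFrobenioidData C_i D_i`, over the data-only
interfaces `BiratData` (Prop. 4.4, "a data-only interface admits junk instances — never quantify universally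
over it", statement file `DivisorMonoidCategoryTheoreticityDefs.lean`) resp. `RSParams` (Def. 4.5 (iii)).
Over the degenerate operations on `C = B(N_{≥1})` of the prequel (`exists_degenerate`: `deg_Fr = id`,
`Div = 0`, `Φ ≡ ℤ_{≥0}`; of standard type over bases with invertible arrows; `Cor411Setting` holds):

* `exists_biratData_faithful` / `exists_biratData_chaotic` — JUNK `BiratData`: `C^birat := C` (identity
  functor) resp. `C^birat := Discrete PUnit`; `exists_rsParams` — JUNK `RSParams` (support `a ≠ 0`,
  `(C^un-tr)^birat := B(ℤ)`, whose object is Frobenius-compact: `O^× = ℤ`) at which the typed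
  `IsOfRationallyStandardType` HOLDS;
* `not_forall_cor410` — a `Ψ^birat` `1`-commuting with the identity and the chaotic functor would make the
  latter faithful (`2 = 1`);
* `not_forall_cor411iii` — over the bases `Discrete PUnit`, `Discrete Bool` there is no `Ψ^Base`.

The forms print asserts and the tree PROVES are the instances at THE constructions (cited, not restated):
Cor. 4.10 at THE birationalizations `PreFrobenioid.cor410_biratData_of_isOfFSMType` /
`…_of_isOfFSMFFType2024` (seat abc-iut-L1-t10), `PreFrobenioid.cor410_biratData_asPrinted` (seat
abc-iut-L1-t13); Cor. 4.11 (iii) `FrdI.cor411iii_of_cor411ii_of_isOfFSMType` (seat abc-iut-L1-t14),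
`cor411iii_arith` (arithmetic Frobenioids, seat abc-iut-L1-d1). So F-1024/F-1027 are admissible AT NAMED
INSTANCES ONLY. Bookkeeping about the typing; nothing here bears on [IUTchIII] Cor. 3.12 or takes a side; a
refuted closure is a statement about the schema, not about the paper.
-/

namespace Literature.AlgebraicGeometry.Frobenioids

open CategoryTheory

namespace PreFrobenioidData

namespace CorSchemaNegative

/-! ### Junk birationalization data and junk "rationally standard" parameters -/

section Junk

variable {D : Type} [Category.{0} D] (S : PreFrobenioidData.{0} (SingleObj ℕ+) D)
  (hdeg : ∀ {x y : SingleObj ℕ+} (φ : x ⟶ y), S.degFr φ = φ)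

/-- The identity is a pull-back morphism (for any operations). [cite: MochizukiFrdI2008, Def. 1.2 (ii) p.21] -/
theorem isPullbackMorphism_id' {C : Type} [Category.{0} C] (T : PreFrobenioidData.{0} C D) (A : C) :
    T.IsPullbackMorphism (𝟙 A) := by
  intro X χ β hβ
  rw [T.base.map_id, Category.comp_id] at hβ
  refine ⟨χ, ⟨Category.comp_id χ, hβ.symm⟩, fun ψ hψ => ?_⟩
  rw [← hψ.1, Category.comp_id]

include hdeg in
/-- JUNK birationalization data over the degenerate operations: `C^birat := C` with the identity functor
(faithful), operations `(Base, 0, deg_Fr)` over the zero monoid, `Φ^birat := Φ^gp`, trivial unit divisors —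
an instance of the data-only interface `BiratData` (NOT the birationalization of Prop. 4.4), which is
birationally Frobenius-normalized (`O^▷ = {1}`). [cite: MochizukiFrdI2008, Prop. 4.4 p.82] -/
theorem exists_biratData_faithful :
    ∃ B : BiratData.{0, 0, 0, 0, 0, 0} S, B.toBirat.Faithful ∧ IsOfBiratFrobeniusNormalizedType B ∧
      ∀ X, B.phiBirat X = ⊤ := by
  refine ⟨{ Birat := SingleObj ℕ+
            toBirat := 𝟭 _
            obj_surjective := fun X => ⟨X, rfl⟩
            ops := { base := S.base
                     Mon := fun _ => PUnit
                     pull := fun _ => 1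
                     pull_id := fun _ _ => rfl
                     pull_comp := fun _ _ _ => rfl
                     div := fun _ => PUnit.unit
                     degFr := fun φ => S.degFr φ
                     div_id := fun _ => rfl
                     div_comp := fun _ _ => rfl
                     degFr_id := S.degFr_id
                     degFr_comp := S.degFr_comp }
            ops_mon_eq_one := fun _ _ => rfl
            overBase := S.base.leftUnitor
            phiBirat := fun _ => ⊤
            divBirat := fun _ => 1
            divBirat_mem := fun _ _ => Subgroup.mem_top _ }, Functor.Faithful.id, ⟨fun A φ _ α hα => ?_⟩,
    fun _ => rfl⟩
  have h1 : S.degFr α = 1 := hα.2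
  have h2 : (show ℕ+ from α) = 1 := (hdeg α).symm.trans h1
  have h3 : α = 1 := h2
  rw [h3, one_pow, one_mul, mul_one]

/-- JUNK birationalization data over operations with base `Discrete PUnit`: `C^birat := Discrete PUnit`
(chaotic: all Hom-sets subsingletons), reached by the constant functor.
[cite: MochizukiFrdI2008, Prop. 4.4 p.82] -/
theorem exists_biratData_chaotic (T : PreFrobenioidData.{0} (SingleObj ℕ+) (Discrete PUnit.{1})) :
    ∃ B : BiratData.{0, 0, 0, 0, 0, 0} T, ∀ X Y : B.Birat, Subsingleton (X ⟶ Y) :=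
  ⟨{ Birat := Discrete PUnit.{1}
     toBirat := Functor.star _
     obj_surjective := fun _ => ⟨SingleObj.star ℕ+, Subsingleton.elim _ _⟩
     ops := { base := 𝟭 _
              Mon := fun _ => PUnit
              pull := fun _ => 1
              pull_id := fun _ _ => rfl
              pull_comp := fun _ _ _ => rfl
              div := fun _ => PUnit.unit
              degFr := fun _ => 1
              div_id := fun _ => rfl
              div_comp := fun _ _ => rfl
              degFr_id := fun _ => rfl
              degFr_comp := fun _ _ => (mul_one 1).symm }
     ops_mon_eq_one := fun _ _ => rfl
     overBase := Functor.punitExt _ _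
     phiBirat := fun _ => ⊤
     divBirat := fun _ => 1
     divBirat_mem := fun _ _ => Subgroup.mem_top _ }, fun _ _ => inferInstance⟩

/-- In `B(ℤ)` (`SingleObj (Multiplicative ℤ)`) the automorphism group of the object is commutative.
[cite: MochizukiFrdI2008, Def. 1.2 (iv) p.23] -/
theorem aut_comm (a b : Aut (SingleObj.star (Multiplicative ℤ))) : a * b = b * a := by
  ext
  change b.hom ≫ a.hom = a.hom ≫ b.hom
  rw [SingleObj.comp_as_mul, SingleObj.comp_as_mul]
  exact mul_comm (show Multiplicative ℤ from a.hom) (show Multiplicative ℤ from b.hom)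

include hdeg in
/-- JUNK "rationally standard" parameters over the degenerate operations of standard type with non-trivial
`Φ`: the junk `BiratData` above, the support predicate `a ≠ 0`, trivial operations on `C^un-tr`, and
`(C^un-tr)^birat := B(ℤ)` whose object is Frobenius-compact (`O^× = ℤ`) — at which the typed Def. 4.5 (iii)
`IsOfRationallyStandardType` HOLDS. [cite: MochizukiFrdI2008, Def. 4.5 (iii) p.86] -/
theorem exists_rsParams (hM : ∀ A : SingleObj ℕ+, ∃ m : S.Mon (S.base.obj A), m ≠ 1) (X₀ : D)
    (hst : S.IsOfStandardType) :
    ∃ R : RSParams.{0, 0, 0, 0, 0, 0} S, S.IsOfRationallyStandardType R := by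
  obtain ⟨B, -, hBN, hphi⟩ := exists_biratData_faithful S hdeg
  let U₀ : S.Untr := ⟨⟨SingleObj.star ℕ+, isIsotropic S hdeg _⟩⟩
  let SU : PreFrobenioidData.{0} S.Untr D :=
    { base := (Functor.const _).obj X₀
      Mon := fun _ => PUnit
      pull := fun _ => 1
      pull_id := fun _ _ => rfl
      pull_comp := fun _ _ _ => rfl
      div := fun _ => PUnit.unit
      degFr := fun _ => 1
      div_id := fun _ => rfl
      div_comp := fun _ _ => rfl
      degFr_id := fun _ => rfl
      degFr_comp := fun _ _ => (mul_one 1).symm }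
  let BU : BiratData.{0, 0, 0, 0, 0, 0} SU :=
    { Birat := SingleObj (Multiplicative ℤ)
      toBirat := (Functor.const _).obj (SingleObj.star _)
      obj_surjective := fun _ => ⟨U₀, rfl⟩
      ops := { base := (Functor.const _).obj X₀
               Mon := fun _ => PUnit
               pull := fun _ => 1
               pull_id := fun _ _ => rfl
               pull_comp := fun _ _ _ => rfl
               div := fun _ => PUnit.unit
               degFr := fun _ => 1
               div_id := fun _ => rfl
               div_comp := fun _ _ => rfl
               degFr_id := fun _ => rfl
               degFr_comp := fun _ _ => (mul_one 1).symm }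
      ops_mon_eq_one := fun _ _ => rfl
      overBase := Iso.refl _
      phiBirat := fun _ => ⊤
      divBirat := fun _ => 1
      divBirat_mem := fun _ _ => Subgroup.mem_top _ }
  refine ⟨{ B := B, Supp := fun a _ => a ≠ 1, SU := SU, BU := BU }, hBN, fun A => ?_, hst, ?_⟩
  · -- rational: the identity pull-back morphism to the strictly rational `A`
    obtain ⟨m, hm⟩ := hM A
    refine ⟨A, 𝟙 A, isPullbackMorphism_id' S A, fun 𝔭 => ⟨m, 1, ?_, hm, fun h => h rfl⟩⟩
    rw [hphi]
    exact Subgroup.mem_top _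
  · -- `(C^un-tr)^birat = B(ℤ)` admits a Frobenius-compact object: `O^× = Aut = ℤ`
    let X : SingleObj (Multiplicative ℤ) := SingleObj.star _
    let u : Aut X := asIso (show X ⟶ X from Multiplicative.ofAdd (1 : ℤ))
    refine ⟨X, fun a _ b _ => aut_comm a b, ⟨u, ⟨rfl, rfl⟩, fun N hN hu => ?_⟩, fun f p q _ a _ => ?_⟩
    · -- `Aut(∗) → End(∗) = ℤ` is a homomorphism, so `u ^ N = 1` forces `N • 1 = 0` in `ℤ`
      let φ : Aut X →* Multiplicative ℤ :=
        (SingleObj.toEnd (Multiplicative ℤ)).symm.toMonoidHom.comp (Aut.toEnd X)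
      have hφu : φ u = Multiplicative.ofAdd (1 : ℤ) := rfl
      have h1 : Multiplicative.ofAdd (1 : ℤ) ^ N = 1 := by rw [← hφu, ← map_pow, hu, map_one]
      rw [← ofAdd_nsmul, Nat.smul_one_eq_cast] at h1
      have h2 : (N : ℤ) = 0 := Multiplicative.ofAdd.injective (h1.trans ofAdd_zero.symm)
      omega
    · exact ⟨1, one_pos, by rw [aut_comm f a, mul_inv_cancel_right]⟩

end Junk

end CorSchemaNegative

open CorSchemaNegative

/-! ### F-1024: the universal closure of `Cor410` is false -/

/-- **F-1024 (FACT-LIST), schema negative.** The universal closure of the typed Cor. 4.10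
`PreFrobenioidData.Cor410` — quantified over the data-only interfaces `PreFrobenioidData` and `BiratData` — is
false: for the degenerate operations on `C = B(N_{≥1})` over `Discrete PUnit` (FSM-type base, quasi-isotropic;
identity `Ψ`) and the junk birationalization data `C^birat := C` (identity functor, faithful) resp.
`C^birat := Discrete PUnit` (chaotic), a `Ψ^birat` `1`-commuting with them would make the chaotic functor
faithful, i.e. `2 = 1` in `N_{≥1}`. The printed statement is the instance at THE birationalizations of
Frobenioids, PROVED in the tree (`PreFrobenioid.cor410_biratData_of_isOfFSMType`,
`…_of_isOfFSMFFType2024`, seat abc-iut-L1-t10; `cor410_biratData_asPrinted`, seat abc-iut-L1-t13).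
[cite: MochizukiFrdI2008, Cor. 4.10 p.90] -/
theorem not_forall_cor410 :
    ¬ ∀ (C₁ : Type) [Category.{0} C₁] (D₁ : Type) [Category.{0} D₁]
        (C₂ : Type) [Category.{0} C₂] (D₂ : Type) [Category.{0} D₂]
        (S₁ : PreFrobenioidData.{0} C₁ D₁) (S₂ : PreFrobenioidData.{0} C₂ D₂) (Ψ : C₁ ≌ C₂)
        (B₁ : BiratData.{0, 0, 0, 0, 0, 0} S₁) (B₂ : BiratData.{0, 0, 0, 0, 0, 0} S₂),
        S₁.Cor410 S₂ Ψ B₁ B₂ := by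
  intro h
  obtain ⟨S, hdeg, hdiv, hM, hpull⟩ := exists_degenerate (D := Discrete PUnit.{1}) ⟨⟨⟩⟩
  obtain ⟨B₁, hB₁, -, -⟩ := exists_biratData_faithful S hdeg
  obtain ⟨B₂, hB₂⟩ := exists_biratData_chaotic S
  have hst := isOfStandardType S hdeg hdiv (fun f => inferInstance) hM hpull
  obtain ⟨Ψbirat, ⟨hE, ⟨η⟩, -⟩, -⟩ := h _ _ _ _ S S CategoryTheory.Equivalence.refl B₁ B₂
    hst.fsmff hst.fsmff hst.quasiIsotropic hst.quasiIsotropic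
  haveI := hE
  haveI := hB₁
  haveI : ((CategoryTheory.Equivalence.refl (C := SingleObj ℕ+)).functor ⋙ B₂.toBirat).Faithful :=
    Functor.Faithful.of_iso η.symm
  let two : SingleObj.star ℕ+ ⟶ SingleObj.star ℕ+ := show ℕ+ from 2
  have h21 : two = 𝟙 _ :=
    ((CategoryTheory.Equivalence.refl (C := SingleObj ℕ+)).functor ⋙ B₂.toBirat).map_injective
      (@Subsingleton.elim _ (hB₂ _ _) _ _)
  have h2 : (2 : ℕ+) = 1 := h21
  exact absurd h2 (by decide)

/-! ### F-1027: the universal closure of `Cor411iii` is false -/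

/-- **F-1027 (FACT-LIST), schema negative.** The universal closure of the typed Cor. 4.11 (iii)
`PreFrobenioidData.Cor411iii` — quantified over the data-only interfaces `PreFrobenioidData` and `RSParams` —
is false: for the degenerate operations on `B(N_{≥1})` over `Discrete PUnit` and `Discrete Bool` (identity `Ψ`)
the hypotheses `Cor411Setting` hold and the junk parameters `exists_rsParams` are "rationally standard", but
there is no base equivalence `Ψ^Base : Discrete PUnit ⥤ Discrete Bool`. The printed statement is the instance
at THE constructions over Frobenioids, PROVED in the tree (`FrdI.cor411iii_of_cor411ii_of_isOfFSMType`, seat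
abc-iut-L1-t14; `cor411iii_arith`, seat abc-iut-L1-d1). [cite: MochizukiFrdI2008, Cor. 4.11 (iii) p.92] -/
theorem not_forall_cor411iii :
    ¬ ∀ (C₁ : Type) [Category.{0} C₁] (D₁ : Type) [Category.{0} D₁]
        (C₂ : Type) [Category.{0} C₂] (D₂ : Type) [Category.{0} D₂]
        (S₁ : PreFrobenioidData.{0} C₁ D₁) (S₂ : PreFrobenioidData.{0} C₂ D₂) (Ψ : C₁ ≌ C₂)
        (R₁ : RSParams.{0, 0, 0, 0, 0, 0} S₁) (R₂ : RSParams.{0, 0, 0, 0, 0, 0} S₂),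
        S₁.Cor411iii S₂ Ψ R₁ R₂ := by
  intro h
  obtain ⟨S₁, hdeg₁, hdiv₁, hM₁, hpull₁⟩ := exists_degenerate (D := Discrete PUnit.{1}) ⟨⟨⟩⟩
  obtain ⟨S₂, hdeg₂, hdiv₂, hM₂, hpull₂⟩ := exists_degenerate (D := Discrete Bool) ⟨true⟩
  have hst₁ := isOfStandardType S₁ hdeg₁ hdiv₁ (fun f => inferInstance) hM₁ hpull₁
  have hst₂ := isOfStandardType S₂ hdeg₂ hdiv₂ (fun f => inferInstance) hM₂ hpull₂
  obtain ⟨R₁, hR₁⟩ := exists_rsParams S₁ hdeg₁ hM₁ ⟨⟨⟩⟩ hst₁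
  obtain ⟨R₂, hR₂⟩ := exists_rsParams S₂ hdeg₂ hM₂ ⟨true⟩ hst₂
  obtain ⟨ΨBase, ⟨hE, -, -⟩, -⟩ := h _ _ _ _ S₁ S₂ CategoryTheory.Equivalence.refl R₁ R₂
    (cor411Setting_of_degenerate S₁ S₂ _ hdeg₁ hdiv₁ hM₁ hpull₁ (fun f => inferInstance)
      (fun X Y => inferInstance) hdeg₂ hdiv₂ hM₂ hpull₂ (fun f => inferInstance) (fun X Y => inferInstance))
    hR₁ hR₂
  haveI := hE
  have e : PUnit.{1} ≃ Bool := Discrete.equivOfEquivalence ΨBase.asEquivalence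
  exact absurd (e.symm.injective (Subsingleton.elim (e.symm true) (e.symm false))) (by decide)

end PreFrobenioidData

end Literature.AlgebraicGeometry.Frobenioids
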